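/-
Copyright (c) 2026 the pub-hodgecm-mathlib formalisation cell (harness21).  Prover seat hodgecm-mathlib-A-p03 (g24); LEAD F0P3a-plan (g9) WORD T8-41 «(F4)–(F8) PEN 1»,
architect A-p06 (g26) (LAYER B «=»), 2026-09-01.  FILE 5 of B-p10 (g24)'s story `UnramifiedQuadraticNorm*`.
-/
import Literature.NumberTheory.LocalFields.UnramifiedQuadraticNormCongruences
import HarnessLib

/-!
# The arithmetic heart of Flicker's Prop. 10, case `ν = N₊ < 2m`: counting pairs `(u, x)` with `N(u)²(1−x²) + d·N(u) + p ≡ 0 (mod 𝔪^k)`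

Topic `NumberTheory/LocalFields`, namespace `Literature.NumberTheory.LocalFields.UnramifiedQuadraticNorm` (FILE 5; FILE 4 = ★ `…Congruences` toolkit (T1)–(T3)).
THEOREMS ONLY: no definition, no named fact, no instance, no notation, no `sorry`; kernel lane.  Road «D-N7-inert», MAP v3 (F4) LAYER B.

THE MATHEMATICS [Flicker1998UnitaryFL, Prop. 10 p. 86, the case «`ν′ = ν″ < m`»].  In the regime `ν = N₊ < 2m ≤ 2ν` the fourth congruence of `H^K_m`-membership is
(★ `condition_four_iff_quadratic`) the quadratic `E_x(n) := n²(1 − x²) + d·n + p ≡ 0 (mod 𝔪^k)` in the NORM `n = uσu`, with `k = 2m − ν ≤ m`, `d` a unit that is σ-fixed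
modulo `𝔪^k`, `p = ϖ^{2j} ∈ 𝔪` (`j ≥ 1`) σ-fixed, and `x` antisymmetric (`σx = −x`).  Over `A = R ⧸ 𝔪^k`:
* `isUnit_one_sub_sq` — `1 − x²` is a unit for antisymmetric `x` (`2` a unit);
* `quadratic_root_unique` — two UNIT roots of `E_x` coincide (`E(n₁) − E(n₂) = (n₁−n₂)((n₁+n₂)(1−x²) + d)`, the bracket = unit + nilpotent);
* `exists_fixed_unit_quadratic_root` — a root exists (the contraction ★ `existsUnique_eq_one_add_mul_mul_sq` for `Δ = 1 + εpΔ²`, `ε = (1−x²)d⁻²`, `n = −d((1−x²)Δ)⁻¹`),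
  and it is the class of a σ-FIXED unit of `R` (apply `σ̄` to the equation; uniqueness; σ-fixed lift ★ `exists_fixed_sub_mem`);
* **`natCard_norm_quadratic_eq`** — hence `#{u ∈ R ⧸ 𝔪^m : E_x(N u) ≡ 0 (mod 𝔪^k)} = q^{m−k}·q^{m−1}(q+1)` for each antisymmetric `x` (★ (T2) `natCard_norm_congr_quotient_pow`);
* **`natCard_antifixed_quotient_pow`** — `#{x ∈ R ⧸ 𝔪^m : σ̄x = −x} = q^m` (multiplication by the antisymmetric unit `σa − a`);
* **`natCard_pairs_norm_quadratic_eq`** — summing: `#{(u, x) : σ̄x = −x, E_x(N u) ≡ 0 (mod 𝔪^k)} = q^m · q^{m−k} · q^{m−1}(q+1)` — Flicker's «a choice of `λ₁`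
  determines `ε` and `Δ` … hence `uū ∈ R^×∕(1+π^{m−ν′}R)` … multiplying by `[P_H : P_H ∩ H^K_m]` we get `(1+q⁻¹)q^{2m+ν}`» (with `k = m − ν′ = 2m − ν` the value is
  `q^m·q^{ν−m}·q^{m−1}(q+1)`, and the remaining factor `q^m` is the fibre size `[N₀ : P_H ∩ H^K_m]` of (F3c-β)).
HONEST LABEL: HC_CM is proved only modulo the printed citations until rung 0 closes; this file is finite commutative algebra.

## References
* [Flicker1998UnitaryFL] Y. Z. Flicker, *Elementary proof of the fundamental lemma for a unitary group*, Canad. J. Math. 50 (1998), 74–98: Prop. 10 p. 86.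
* [Serre1979] J.-P. Serre, *Local Fields*, GTM 67 (1979), Ch. V §2.
-/

set_option autoImplicit false

namespace Literature.NumberTheory.LocalFields.UnramifiedQuadraticNorm

open Literature.LinearAlgebra.Matrix.HermitianFormsHensel Literature.NumberTheory.GaloisRepresentations IsLocalRing

universe u

/-! ## §1 Algebra in a commutative ring `A` (= `R ⧸ 𝔪^k`) with an involution -/

section Algebra

variable {A : Type u} [CommRing A]

/-- `1 − x²` is a unit when `τx = −x` for an involutive ring endomorphism `τ` of a LOCAL ring in which `2` is a unit (`1 − x² = (1+x)(1−x)`, `τ(1+x) = 1−x`,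
`(1+x) + (1−x) = 2`). [cite: Flicker1998UnitaryFL, Prop. 10 p. 86] -/
theorem isUnit_one_sub_sq [IsLocalRing A] (τ : A →+* A) (hττ : ∀ y, τ (τ y) = y) (h2 : IsUnit (2 : A)) {x : A} (hx : τ x = -x) :
    IsUnit (1 - x ^ 2) := by
  have hfac : (1 : A) - x ^ 2 = (1 + x) * (1 - x) := by ring
  have hτ : τ (1 + x) = 1 - x := by rw [map_add, map_one, hx]; ring
  have hτ' : τ (1 - x) = 1 + x := by rw [← hτ, hττ]
  have h1 : IsUnit (1 + x) := by
    by_contra hnu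
    have hm : 1 + x ∈ maximalIdeal A := (mem_maximalIdeal _).2 hnu
    have hm' : 1 - x ∈ maximalIdeal A := by
      refine (mem_maximalIdeal _).2 fun hu => hnu ?_
      rw [← hτ']; exact hu.map τ
    have : (2 : A) ∈ maximalIdeal A := by
      have := Ideal.add_mem _ hm hm'; rwa [show (1 + x) + (1 - x) = (2 : A) by ring] at this
    exact (mem_maximalIdeal _).1 this h2
  rw [hfac]
  exact h1.mul (by rw [← hτ]; exact h1.map τ)

/-- **Uniqueness of unit roots**: if `p` is nilpotent, `1 − x²` is a unit and `n₁, n₂` are UNIT roots of `E(n) = n²(1−x²) + d n + p`, then `n₁ = n₂`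
(`E(n₁) − E(n₂) = (n₁ − n₂)·((n₁+n₂)(1−x²) + d)` and `n₂(n₂(1−x²) + d) = −p` makes the bracket `n₁(1−x²) + (nilpotent)`, a unit). [cite: Flicker1998UnitaryFL, Prop. 10 p. 86] -/
theorem quadratic_root_unique {x d p n₁ n₂ : A} (hp : IsNilpotent p) (h1x : IsUnit (1 - x ^ 2)) (hn₁ : IsUnit n₁) (hn₂ : IsUnit n₂)
    (hE₁ : n₁ ^ 2 * (1 - x ^ 2) + d * n₁ + p = 0) (hE₂ : n₂ ^ 2 * (1 - x ^ 2) + d * n₂ + p = 0) : n₁ = n₂ := by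
  -- the bracket is a unit: n₂⁻¹·(n₂(1−x²) + d)·n₂ = −p nilpotent
  obtain ⟨v₂, hv₂⟩ := hn₂
  have hbr : n₂ * (1 - x ^ 2) + d = -(p * ↑v₂⁻¹) := by
    have h : n₂ * (n₂ * (1 - x ^ 2) + d) = -p := by linear_combination hE₂
    rw [← hv₂] at h ⊢
    calc ↑v₂ * (1 - x ^ 2) + d = ↑v₂⁻¹ * (↑v₂ * (↑v₂ * (1 - x ^ 2) + d)) := by rw [← mul_assoc, Units.inv_mul, one_mul]
      _ = -(p * ↑v₂⁻¹) := by rw [h]; ring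
  have hnil : IsNilpotent (n₂ * (1 - x ^ 2) + d) := by
    rw [hbr]; exact (Commute.isNilpotent_mul_right (Commute.all _ _) hp).neg
  have hunit : IsUnit ((n₁ + n₂) * (1 - x ^ 2) + d) := by
    have e : (n₁ + n₂) * (1 - x ^ 2) + d = n₁ * (1 - x ^ 2) + (n₂ * (1 - x ^ 2) + d) := by ring
    rw [e]
    obtain ⟨w, hw⟩ := hn₁.mul h1x
    rw [← hw]
    have : (↑w : A) + (n₂ * (1 - x ^ 2) + d) = ↑w * (1 + ↑w⁻¹ * (n₂ * (1 - x ^ 2) + d)) := by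
      rw [mul_add, mul_one, ← mul_assoc, Units.mul_inv, one_mul]
    rw [this]
    exact (Units.isUnit w).mul (IsNilpotent.isUnit_one_add (Commute.isNilpotent_mul_left (Commute.all _ _) hnil))
  have hprod : (n₁ - n₂) * ((n₁ + n₂) * (1 - x ^ 2) + d) = 0 := by linear_combination hE₁ - hE₂
  exact sub_eq_zero.mp (hunit.mul_left_eq_zero.mp hprod)

/-- **Existence of a unit root** (the contraction step ★ `existsUnique_eq_one_add_mul_mul_sq`): with `p` nilpotent and `1 − x²`, `d` units, `E(n) = n²(1−x²) + dn + p` has a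
unit root — `n = −d((1−x²)Δ)⁻¹` where `Δ = 1 + εpΔ²`, `ε = (1−x²)d⁻²` (Flicker's `Δ`, p. 86). [cite: Flicker1998UnitaryFL, Prop. 10 p. 86] -/
theorem exists_unit_quadratic_root {x d p : A} (hp : IsNilpotent p) (h1x : IsUnit (1 - x ^ 2)) (hd : IsUnit d) :
    ∃ n : A, IsUnit n ∧ n ^ 2 * (1 - x ^ 2) + d * n + p = 0 := by
  obtain ⟨w, hw⟩ := h1x
  obtain ⟨δ, hδ⟩ := hd
  obtain ⟨Δ, hΔ, -⟩ := existsUnique_eq_one_add_mul_mul_sq hp ((1 - x ^ 2) * (↑δ⁻¹ : A) ^ 2)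
  have hΔu : IsUnit Δ := by
    rw [hΔ]
    exact IsNilpotent.isUnit_one_add
      (Commute.isNilpotent_mul_right (Commute.all _ _) (Commute.isNilpotent_mul_left (Commute.all _ _) hp))
  obtain ⟨Δ', hΔ'⟩ := hΔu
  refine ⟨-(d * (↑w⁻¹ : A) * (↑Δ'⁻¹ : A)), ?_, ?_⟩
  · exact ((hδ ▸ Units.isUnit δ).mul (Units.isUnit w⁻¹) |>.mul (Units.isUnit Δ'⁻¹)).neg
  · set n : A := -(d * (↑w⁻¹ : A) * (↑Δ'⁻¹ : A)) with hn
    have hwinv : (↑w⁻¹ : A) * (1 - x ^ 2) = 1 := by rw [← hw, Units.inv_mul]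
    have hΔinv : (↑Δ'⁻¹ : A) * Δ = 1 := by rw [← hΔ', Units.inv_mul]
    have hδinv : d * (↑δ⁻¹ : A) = 1 := by rw [← hδ, Units.mul_inv]
    have key : n * (1 - x ^ 2) * Δ = -d := by
      rw [hn]; linear_combination (-(d * ((↑Δ'⁻¹ : A) * Δ))) * hwinv + (-d) * hΔinv
    have hu : IsUnit ((1 - x ^ 2) * Δ ^ 2) := (hw ▸ Units.isUnit w).mul ((hΔ' ▸ Units.isUnit Δ').pow 2)
    refine (hu.mul_left_eq_zero).1 ?_
    have h1 : 1 - Δ = -((1 - x ^ 2) * (↑δ⁻¹ : A) ^ 2 * p * Δ ^ 2) := by linear_combination (-1 : A) * hΔ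
    calc (n ^ 2 * (1 - x ^ 2) + d * n + p) * ((1 - x ^ 2) * Δ ^ 2)
        = (n * (1 - x ^ 2) * Δ) ^ 2 + d * Δ * (n * (1 - x ^ 2) * Δ) + p * (1 - x ^ 2) * Δ ^ 2 := by ring
      _ = d ^ 2 * (1 - Δ) + p * (1 - x ^ 2) * Δ ^ 2 := by rw [key]; ring
      _ = p * (1 - x ^ 2) * Δ ^ 2 * (1 - (d * (↑δ⁻¹ : A)) ^ 2) := by rw [h1]; ring
      _ = 0 := by rw [hδinv]; ring

/-- **The unit root is `τ`-fixed** when `τ` is a ring endomorphism with `τx = −x`, `τd = d`, `τp = p` (apply `τ` to the equation and use uniqueness).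
[cite: Flicker1998UnitaryFL, Prop. 10 p. 86] -/
theorem quadratic_root_fixed (τ : A →+* A) {x d p n : A} (hp : IsNilpotent p) (h1x : IsUnit (1 - x ^ 2)) (hn : IsUnit n)
    (hx : τ x = -x) (hτd : τ d = d) (hτp : τ p = p) (hE : n ^ 2 * (1 - x ^ 2) + d * n + p = 0) : τ n = n := by
  have hE' : (τ n) ^ 2 * (1 - x ^ 2) + d * τ n + p = 0 := by
    have := congrArg τ hE
    rw [map_add, map_add, map_mul, map_mul, map_pow, map_sub, map_one, map_pow, hx, hτd, hτp, map_zero, neg_sq] at this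
    exact this
  exact quadratic_root_unique hp h1x (hn.map τ) hn hE' hE

end Algebra

/-! ## §2 The counts over `R ⧸ 𝔪^m` -/

section Count

variable {R : Type u} [CommRing R] (σ : R →+* R)
variable [IsDomain R] [IsDiscreteValuationRing R] [Finite (ResidueField R)] [IsAdicComplete (maximalIdeal R) R]
  (hσ : ∀ a, σ (σ a) = a) {a : R} (ha : IsUnit (σ a - a)) {q : ℕ} (hq : Nat.card (ResidueField R) = q ^ 2)

omit [Finite (ResidueField R)] [IsAdicComplete (maximalIdeal R) R] in
include hσ ha hq in
/-- **`#{x ∈ R ⧸ 𝔪^m : σ̄x = −x} = q^m`**: multiplication by the antisymmetric unit `δ = σa − a` is a bijection from the `σ̄`-fixed classes onto the anti-fixed ones, and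
`|Fix σ̄_m| = q^m` (★ FILE 1). [cite: Serre1979, Ch. V §2 Prop. 2–3] [cite: Flicker1998UnitaryFL, Prop. 8 p. 85] -/
theorem natCard_antifixed_quotient_pow (m : ℕ) :
    Nat.card {x : R ⧸ maximalIdeal R ^ m // Ideal.quotientMap (maximalIdeal R ^ m) σ (maximalIdeal_pow_le_comap σ hσ m) x = -x} = q ^ m := by
  obtain ⟨δ, hδ⟩ := ha
  have hσe : Ideal.quotientMap (maximalIdeal R ^ m) σ (maximalIdeal_pow_le_comap σ hσ m) (Ideal.Quotient.mk _ (σ a - a)) =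
      -Ideal.Quotient.mk _ (σ a - a) := by
    rw [quotientMap_mk σ hσ m, map_sub, hσ, ← map_neg, neg_sub]
  have heu : IsUnit (Ideal.Quotient.mk (maximalIdeal R ^ m) (σ a - a)) := by rw [← hδ]; exact (Units.isUnit δ).map _
  obtain ⟨eu, heu'⟩ := heu
  -- σ̄(eu⁻¹) = −eu⁻¹
  have hσeu : Ideal.quotientMap (maximalIdeal R ^ m) σ (maximalIdeal_pow_le_comap σ hσ m) (↑eu⁻¹ : R ⧸ maximalIdeal R ^ m) = -↑eu⁻¹ := by
    set σm := Ideal.quotientMap (maximalIdeal R ^ m) σ (maximalIdeal_pow_le_comap σ hσ m)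
    have h1 : σm (↑eu : R ⧸ maximalIdeal R ^ m) * σm (↑eu⁻¹ : R ⧸ maximalIdeal R ^ m) = 1 := by rw [← map_mul, Units.mul_inv, map_one]
    rw [heu', hσe, ← heu'] at h1
    -- h1 : -↑eu * σm ↑eu⁻¹ = 1
    have h2 : (↑eu : R ⧸ maximalIdeal R ^ m) * σm ↑eu⁻¹ = -1 := by linear_combination (-1 : R ⧸ maximalIdeal R ^ m) * h1
    calc σm (↑eu⁻¹ : R ⧸ maximalIdeal R ^ m) = ↑eu⁻¹ * ((↑eu : R ⧸ maximalIdeal R ^ m) * σm ↑eu⁻¹) := by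
          rw [← mul_assoc, Units.inv_mul, one_mul]
      _ = ↑eu⁻¹ * (-1) := by rw [h2]
      _ = -↑eu⁻¹ := by ring
  rw [← natCard_fixed_quotient_pow σ hσ ⟨δ, hδ⟩ hq m]
  refine Nat.card_congr
    { toFun := fun x => ⟨x.1 * ↑eu⁻¹, ?_⟩
      invFun := fun y => ⟨y.1 * ↑eu, ?_⟩
      left_inv := fun x => Subtype.ext (by simp [mul_assoc])
      right_inv := fun y => Subtype.ext (by simp [mul_assoc]) }
  · rw [map_mul, x.2, hσeu]; ring
  · rw [map_mul, y.2, heu', hσe, ← heu']; ring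

omit [Finite (ResidueField R)] [IsAdicComplete (maximalIdeal R) R] in
/-- `R ⧸ 𝔪^k` is non-trivial for `k ≥ 1`. [cite: Serre1979, Ch. V §2] -/
theorem nontrivial_quotient_pow {k : ℕ} (hk : 1 ≤ k) : Nontrivial (R ⧸ maximalIdeal R ^ k) := by
  refine Ideal.Quotient.nontrivial_iff.2 fun h => ?_
  have : maximalIdeal R ^ k ≤ maximalIdeal R := Ideal.pow_le_self (by omega)
  rw [h, top_le_iff] at this
  exact Ideal.IsMaximal.ne_top inferInstance this

omit [Finite (ResidueField R)] [IsAdicComplete (maximalIdeal R) R] in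
/-- A class modulo `𝔪^k` (`k ≥ 1`) is a unit only if its representative is. [cite: Serre1979, Ch. V §2] -/
theorem isUnit_of_isUnit_mk_pow {k : ℕ} (hk : 1 ≤ k) {t : R} (ht : IsUnit (Ideal.Quotient.mk (maximalIdeal R ^ k) t)) : IsUnit t := by
  by_contra hnu
  have htm : t ∈ maximalIdeal R := (mem_maximalIdeal _).2 hnu
  have hpow : (Ideal.Quotient.mk (maximalIdeal R ^ k) t) ^ k = 0 := by
    rw [← map_pow, Ideal.Quotient.eq_zero_iff_mem]; exact Ideal.pow_mem_pow htm k
  have h1 : IsUnit ((Ideal.Quotient.mk (maximalIdeal R ^ k) t) ^ k) := ht.pow k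
  rw [hpow] at h1
  haveI := nontrivial_quotient_pow (R := R) hk
  exact not_isUnit_zero h1

include hσ ha hq in
/-- **Per-`x` count** (Flicker's «`Δ` is uniquely determined modulo `π^{m−ν′}` … hence `uū ∈ R^× ∕ (1 + π^{m−ν′}R)`»): for `1 ≤ k ≤ m`, a unit `d` σ-fixed modulo `𝔪^k`,
`p ∈ 𝔪` σ-fixed, `2` a unit and an antisymmetric class `x` mod `𝔪^m`,
`#{u ∈ (R ⧸ 𝔪^m)ˣ : N(u)²(1 − x²) + d·N(u) + p ≡ 0 (mod 𝔪^k)} = q^{m−k} · q^{m−1}(q+1)`. [cite: Flicker1998UnitaryFL, Prop. 10 p. 86] -/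
theorem natCard_norm_quadratic_eq {k m : ℕ} (hk : 1 ≤ k) (hkm : k ≤ m) (h2 : IsUnit (2 : R)) {d p : R} (hd : IsUnit d)
    (hσd : σ d - d ∈ maximalIdeal R ^ k) (hp : p ∈ maximalIdeal R) (hσp : σ p = p)
    (x : R ⧸ maximalIdeal R ^ m) (hx : Ideal.quotientMap (maximalIdeal R ^ m) σ (maximalIdeal_pow_le_comap σ hσ m) x = -x) :
    Nat.card {u : R ⧸ maximalIdeal R ^ m // IsUnit u ∧
      Ideal.Quotient.factor (Ideal.pow_le_pow_right hkm)
        ((u * Ideal.quotientMap (maximalIdeal R ^ m) σ (maximalIdeal_pow_le_comap σ hσ m) u) ^ 2 * (1 - x ^ 2) +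
          Ideal.Quotient.mk _ d * (u * Ideal.quotientMap (maximalIdeal R ^ m) σ (maximalIdeal_pow_le_comap σ hσ m) u) + Ideal.Quotient.mk _ p) = 0} =
      q ^ (m - k) * (q ^ (m - 1) * (q + 1)) := by
  set σm := Ideal.quotientMap (maximalIdeal R ^ m) σ (maximalIdeal_pow_le_comap σ hσ m) with hσm
  set σk := Ideal.quotientMap (maximalIdeal R ^ k) σ (maximalIdeal_pow_le_comap σ hσ k) with hσk
  set φ := Ideal.Quotient.factor (S := maximalIdeal R ^ m) (T := maximalIdeal R ^ k) (Ideal.pow_le_pow_right hkm) with hφ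
  haveI : Nontrivial (R ⧸ maximalIdeal R ^ k) := nontrivial_quotient_pow (R := R) hk
  haveI : IsLocalRing (R ⧸ maximalIdeal R ^ k) :=
    IsLocalRing.of_surjective' (Ideal.Quotient.mk (maximalIdeal R ^ k)) Ideal.Quotient.mk_surjective
  have hσkσk : ∀ y, σk (σk y) = y := quotientMap_quotientMap σ hσ k
  have hφσ : ∀ y, φ (σm y) = σk (φ y) := fun y => factor_quotientMap σ hσ hkm y
  -- the data in `A = R ⧸ 𝔪^k`
  have hxk' : σk (φ x) = -(φ x) := by rw [← hφσ, hx, map_neg]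
  have hdku : IsUnit (Ideal.Quotient.mk (maximalIdeal R ^ k) d) := hd.map _
  have hσdk : σk (Ideal.Quotient.mk (maximalIdeal R ^ k) d) = Ideal.Quotient.mk (maximalIdeal R ^ k) d := by
    rw [hσk, quotientMap_mk σ hσ k, Ideal.Quotient.eq]; exact hσd
  have hσpk : σk (Ideal.Quotient.mk (maximalIdeal R ^ k) p) = Ideal.Quotient.mk (maximalIdeal R ^ k) p := by
    rw [hσk, quotientMap_mk σ hσ k, hσp]
  have hpk_nil : IsNilpotent (Ideal.Quotient.mk (maximalIdeal R ^ k) p) :=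
    ⟨k, by rw [← map_pow, Ideal.Quotient.eq_zero_iff_mem]; exact Ideal.pow_mem_pow hp k⟩
  have h2k : IsUnit (2 : R ⧸ maximalIdeal R ^ k) := by
    have := h2.map (Ideal.Quotient.mk (maximalIdeal R ^ k)); rwa [map_ofNat] at this
  have h1x : IsUnit (1 - (φ x) ^ 2) := isUnit_one_sub_sq σk hσkσk h2k hxk'
  -- the unique, σ-fixed unit root `c`, lifted to a σ-fixed unit `r` of `R`
  obtain ⟨c, hcu, hcE⟩ := exists_unit_quadratic_root hpk_nil h1x hdku
  have hσc : σk c = c := quadratic_root_fixed σk hpk_nil h1x hcu hxk' hσdk hσpk hcE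
  obtain ⟨r₀, hr₀⟩ := Ideal.Quotient.mk_surjective c
  have hmem : σ r₀ - r₀ ∈ maximalIdeal R ^ k := by
    rw [← Ideal.Quotient.eq_zero_iff_mem, map_sub, sub_eq_zero, ← quotientMap_mk σ hσ k, ← hσk, hr₀]; exact hσc
  obtain ⟨r, hr, hrr⟩ := exists_fixed_sub_mem σ hσ ha hmem
  have hrc : Ideal.Quotient.mk (maximalIdeal R ^ k) r = c := by rw [← hr₀, Ideal.Quotient.eq]; exact hrr
  have hru : IsUnit r := isUnit_of_isUnit_mk_pow hk (by rw [hrc]; exact hcu)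
  -- identify the set with the norm fibre over `r̄`
  rw [← natCard_norm_congr_quotient_pow σ hσ ha hq hk hkm hru hr]
  refine Nat.card_congr (Equiv.subtypeEquivRight fun u => ?_)
  -- `φ(E_m(N u)) = E_k(φ(N u))`
  have hE : φ ((u * σm u) ^ 2 * (1 - x ^ 2) + Ideal.Quotient.mk (maximalIdeal R ^ m) d * (u * σm u) + Ideal.Quotient.mk (maximalIdeal R ^ m) p) =
      (φ (u * σm u)) ^ 2 * (1 - (φ x) ^ 2) + Ideal.Quotient.mk (maximalIdeal R ^ k) d * φ (u * σm u) + Ideal.Quotient.mk (maximalIdeal R ^ k) p := by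
    simp only [map_add, map_mul, map_pow, map_sub, map_one, hφ, Ideal.Quotient.factor_mk]
  show IsUnit u ∧ φ _ = 0 ↔ φ (u * σm u) = _
  constructor
  · rintro ⟨huu, hzero⟩
    rw [hE] at hzero
    have hNu : IsUnit (φ (u * σm u)) := (huu.mul (huu.map σm)).map φ
    rw [quadratic_root_unique hpk_nil h1x hNu hcu hzero hcE, ← hrc]
  · intro hNr
    have hNr' : φ (u * σm u) = c := by rw [hNr, hrc]
    refine ⟨?_, by rw [hE, hNr']; exact hcE⟩
    -- `u` is a unit since `φ(N u) = c` is
    obtain ⟨u₀, rfl⟩ := Ideal.Quotient.mk_surjective u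
    have hNu₀ : IsUnit (Ideal.Quotient.mk (maximalIdeal R ^ k) (u₀ * σ u₀)) := by
      have : φ (Ideal.Quotient.mk (maximalIdeal R ^ m) u₀ * σm (Ideal.Quotient.mk (maximalIdeal R ^ m) u₀)) =
          Ideal.Quotient.mk (maximalIdeal R ^ k) (u₀ * σ u₀) := by
        rw [hσm, quotientMap_mk σ hσ m, ← map_mul, hφ, Ideal.Quotient.factor_mk]
      rw [← this, hNr']; exact hcu
    exact (isUnit_of_mul_isUnit_left (isUnit_of_isUnit_mk_pow hk hNu₀)).map _

include hσ ha hq in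
/-- **THE PAIR COUNT** (Flicker's case «`ν′ = ν″ < m`» of Prop. 10, arithmetic form): for `1 ≤ k ≤ m`, a unit `d` σ-fixed modulo `𝔪^k`, `p ∈ 𝔪` σ-fixed and `2` a unit,
`#{(u, x) ∈ (R ⧸ 𝔪^m)ˣ × (R ⧸ 𝔪^m) : σ̄x = −x, N(u)²(1 − x²) + d·N(u) + p ≡ 0 (mod 𝔪^k)} = q^m · q^{m−k} · q^{m−1}(q+1)` — with `k = 2m − ν` this is `q^m · q^{ν−1}(q+1)`,
and times the fibre size `q^m` of `P_H ⧸ (P_H ∩ H^K_m) → (u, x mod ϖ^m)` it is Flicker's `(1 + q⁻¹) q^{ν+2m}` (★ `iTen`, third branch). [cite: Flicker1998UnitaryFL, Prop. 10 p. 86] -/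
theorem natCard_pairs_norm_quadratic_eq {k m : ℕ} (hk : 1 ≤ k) (hkm : k ≤ m) (h2 : IsUnit (2 : R)) {d p : R} (hd : IsUnit d)
    (hσd : σ d - d ∈ maximalIdeal R ^ k) (hp : p ∈ maximalIdeal R) (hσp : σ p = p) :
    Nat.card {ux : (R ⧸ maximalIdeal R ^ m) × (R ⧸ maximalIdeal R ^ m) //
      Ideal.quotientMap (maximalIdeal R ^ m) σ (maximalIdeal_pow_le_comap σ hσ m) ux.2 = -ux.2 ∧ (IsUnit ux.1 ∧
      Ideal.Quotient.factor (Ideal.pow_le_pow_right hkm)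
        ((ux.1 * Ideal.quotientMap (maximalIdeal R ^ m) σ (maximalIdeal_pow_le_comap σ hσ m) ux.1) ^ 2 * (1 - ux.2 ^ 2) +
          Ideal.Quotient.mk _ d * (ux.1 * Ideal.quotientMap (maximalIdeal R ^ m) σ (maximalIdeal_pow_le_comap σ hσ m) ux.1) + Ideal.Quotient.mk _ p) = 0)} =
      q ^ m * (q ^ (m - k) * (q ^ (m - 1) * (q + 1))) := by
  classical
  haveI := CompleteLocalRing.finite_quotient_maximalIdeal_pow (R := R) m
  set σm := Ideal.quotientMap (maximalIdeal R ^ m) σ (maximalIdeal_pow_le_comap σ hσ m) with hσm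
  set φ := Ideal.Quotient.factor (S := maximalIdeal R ^ m) (T := maximalIdeal R ^ k) (Ideal.pow_le_pow_right hkm) with hφ
  let P : R ⧸ maximalIdeal R ^ m → Prop := fun x => σm x = -x
  let Q : (R ⧸ maximalIdeal R ^ m) → (R ⧸ maximalIdeal R ^ m) → Prop := fun x u => IsUnit u ∧
    φ ((u * σm u) ^ 2 * (1 - x ^ 2) + Ideal.Quotient.mk _ d * (u * σm u) + Ideal.Quotient.mk _ p) = 0
  let X := {x : R ⧸ maximalIdeal R ^ m // P x}
  haveI : Finite X := Subtype.finite
  letI : Fintype X := Fintype.ofFinite X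
  -- pairs ≃ Σ x, fibre
  have e : {ux : (R ⧸ maximalIdeal R ^ m) × (R ⧸ maximalIdeal R ^ m) // P ux.2 ∧ Q ux.2 ux.1} ≃ Σ x : X, {u : R ⧸ maximalIdeal R ^ m // Q x.1 u} :=
    { toFun := fun ux => ⟨⟨ux.1.2, ux.2.1⟩, ⟨ux.1.1, ux.2.2⟩⟩
      invFun := fun y => ⟨(y.2.1, y.1.1), y.1.2, y.2.2⟩
      left_inv := fun ux => rfl
      right_inv := fun y => rfl }
  rw [Nat.card_congr e, Nat.card_sigma]
  have hfib : ∀ x : X, Nat.card {u : R ⧸ maximalIdeal R ^ m // Q x.1 u} = q ^ (m - k) * (q ^ (m - 1) * (q + 1)) :=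
    fun x => natCard_norm_quadratic_eq σ hσ ha hq hk hkm h2 hd hσd hp hσp x.1 x.2
  rw [Finset.sum_congr rfl fun x _ => hfib x, Finset.sum_const, smul_eq_mul, Finset.card_univ, ← Nat.card_eq_fintype_card]
  congr 1
  exact natCard_antifixed_quotient_pow σ hσ ha hq m

end Count

end Literature.NumberTheory.LocalFields.UnramifiedQuadraticNorm
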